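import Mathlib.Data.Matrix.Basic
import Mathlib.Analysis.SpecialFunctions.Pow.Real
import Mathlib.Analysis.SpecialFunctions.Sqrt

/-!
# Powers of the symmetrically normalised adjacency matrix are diagonal conjugates of random-walk powers (DEQ-A110 support)

HONEST FRAMING: instance-level adjudication of specific advantage claims; no claim about
BQP vs BPP or the summit.

Liao–Zhang–Ferrie (arXiv:2405.17060v1, §3.2 and §6.2, Table 1) implement the Simplified Graph
Convolution `softmax(Â^K X Θ)`, `Â = D̃^{-1/2} Ã D̃^{-1/2}`, on a quantum computer and compare circuit
depth with classical sequential work.  DEQ-A110 (Theorem A110-A(a)) rests on the elementary identity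
recorded here with no `sorry`: for any matrix `A` and positive weights `d`,
`(D^{-1/2} A D^{-1/2})^K = D^{1/2} (D^{-1} A)^K D^{-1/2}` (`normalizedAdj_pow`), whence entrywise
`((D^{-1/2} A D^{-1/2})^K X)_{ic} = Σ_l (P^K)_{il} · √(d_i) (√(d_l))⁻¹ · X_{lc}` with `P = D^{-1} A`
(`normalizedAdj_pow_mul_apply`).  When `A = Ã` is the adjacency matrix with self-loops and
`d = d̃` its row sums, `P` is the transition matrix of the simple random walk, `(P^K)_{il}` is the
probability that a `K`-step walk from `i` ends at `l`, and the right-hand side is the expectation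
`E_i[(d̃_i/d̃_{J_K})^{1/2} X_{J_K,c}]` — the `r = 1/2` case of the Monte-Carlo propagation identity of
Chen et al., *Scalable Graph Neural Networks via Bidirectional Propagation* (NeurIPS 2020,
arXiv:2010.15421, §3.1), which is reference [64] of arXiv:2405.17060.  It makes every output the
quantum SGC pipeline defines computable classically at a cost independent of the number of nodes and
edges (DEQ-A110 §3).  Only `Matrix.diagonal` algebra from Mathlib is used.
-/

namespace Summit.QuantumAdvantage.Dequantization.NormalizedAdjacencyWalk

open Matrix

variable {n m : Type*} [Fintype n] [DecidableEq n]

/-- Conjugation by a diagonal matrix with an entrywise inverse commutes with powers: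
`(diag u · P · diag v)^K = diag u · P^K · diag v` when `u i * v i = 1` for all `i`. [folklore] -/
theorem diagonal_conj_pow (u v : n → ℝ) (huv : ∀ i, u i * v i = 1) (P : Matrix n n ℝ) (K : ℕ) :
    (diagonal u * P * diagonal v) ^ K = diagonal u * P ^ K * diagonal v := by
  have hvu : diagonal v * diagonal u = (1 : Matrix n n ℝ) := by
    rw [diagonal_mul_diagonal, ← diagonal_one]
    congr 1
    funext i
    rw [mul_comm]
    exact huv i
  induction K with
  | zero =>
    rw [pow_zero, pow_zero, Matrix.mul_one, diagonal_mul_diagonal, ← diagonal_one]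
    congr 1
    funext i
    exact (huv i).symm
  | succ K ih =>
    rw [pow_succ, ih, pow_succ]
    calc diagonal u * P ^ K * diagonal v * (diagonal u * P * diagonal v)
        = diagonal u * P ^ K * (diagonal v * diagonal u) * P * diagonal v := by
          simp only [Matrix.mul_assoc]
      _ = diagonal u * (P ^ K * P) * diagonal v := by
          rw [hvu, Matrix.mul_one, Matrix.mul_assoc (diagonal u)]

/-- **Theorem A110-A(a) of DEQ-A110 (matrix form).**  For positive weights `d` and any square
matrix `A`, the `K`-th power of the symmetrically normalised matrix `D^{-1/2} A D^{-1/2}` is the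
diagonal conjugate `D^{1/2} (D^{-1} A)^K D^{-1/2}` of the `K`-th power of the row-normalised
("random-walk") matrix `D^{-1} A`.  [folklore; the `r = 1/2` case of Chen et al. arXiv:2010.15421 §3.1] -/
theorem normalizedAdj_pow (d : n → ℝ) (hd : ∀ i, 0 < d i) (A : Matrix n n ℝ) (K : ℕ) :
    (diagonal (fun i => (Real.sqrt (d i))⁻¹) * A * diagonal (fun i => (Real.sqrt (d i))⁻¹)) ^ K
      = diagonal (fun i => Real.sqrt (d i)) * (diagonal (fun i => (d i)⁻¹) * A) ^ K
        * diagonal (fun i => (Real.sqrt (d i))⁻¹) := by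
  have hs : ∀ i, Real.sqrt (d i) ≠ 0 := fun i => (Real.sqrt_pos.mpr (hd i)).ne'
  have hsq : ∀ i, Real.sqrt (d i) * Real.sqrt (d i) = d i := fun i => Real.mul_self_sqrt (hd i).le
  have key : diagonal (fun i => (Real.sqrt (d i))⁻¹) * A * diagonal (fun i => (Real.sqrt (d i))⁻¹)
      = diagonal (fun i => Real.sqrt (d i)) * (diagonal (fun i => (d i)⁻¹) * A)
        * diagonal (fun i => (Real.sqrt (d i))⁻¹) := by
    rw [← Matrix.mul_assoc (diagonal _) (diagonal _) A, diagonal_mul_diagonal]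
    congr 3
    funext i
    have h1 : d i ≠ 0 := (hd i).ne'
    rw [eq_comm, mul_inv_eq_iff_eq_mul₀ h1, eq_inv_mul_iff_mul_eq₀ (hs i)]
    exact hsq i
  rw [key]
  exact diagonal_conj_pow _ _ (fun i => mul_inv_cancel₀ (hs i)) _ K

/-- **Theorem A110-A(a) of DEQ-A110 (entrywise / random-walk form).**  With `P = D^{-1} A`,
`((D^{-1/2} A D^{-1/2})^K X)_{ic} = Σ_l (P^K)_{il} · (√(d_i) · (√(d_l))⁻¹) · X_{lc}`; for `A` the
adjacency matrix with self-loops and `d` its row sums, `(P^K)_{il}` is the `K`-step walk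
probability from `i` to `l`, so the row `i` of `Â^K X` is the expectation of
`(d_i/d_{J_K})^{1/2} X_{J_K,·}` over `K`-step simple random walks from `i`. [folklore; as above] -/
theorem normalizedAdj_pow_mul_apply (d : n → ℝ) (hd : ∀ i, 0 < d i) (A : Matrix n n ℝ)
    (X : Matrix n m ℝ) (K : ℕ) (i : n) (c : m) :
    ((diagonal (fun i => (Real.sqrt (d i))⁻¹) * A * diagonal (fun i => (Real.sqrt (d i))⁻¹)) ^ K
        * X) i c
      = ∑ l, ((diagonal (fun i => (d i)⁻¹) * A) ^ K) i l
          * (Real.sqrt (d i) * (Real.sqrt (d l))⁻¹) * X l c := by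
  rw [normalizedAdj_pow d hd A K, Matrix.mul_apply]
  refine Finset.sum_congr rfl fun l _ => ?_
  rw [mul_diagonal, diagonal_mul]
  ring

end Summit.QuantumAdvantage.Dequantization.NormalizedAdjacencyWalk
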